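import Literature.Analysis.FunctionSpaces.TorusScalarFourierSeries
import Literature.Analysis.FunctionSpaces.TorusPeriodizationCube
import Literature.Algebra.EuclideanLattices.LatticeDescentFourier
import HarnessLib

/-!
# Fourier expansion of a smooth function supported in the open unit cube, with coefficient decay

Helper toward the registered stub `stub_tensorisation` of crux AtomicSynthesis ⟨stmt-QuantumFields-28126⟩
(LINE «SlotwiseSynthesis», ym-idea-11 g13).  For a smooth `g : ℝ^d → ℂ` whose topological support lies in
the open unit cube `(0,1)^d` we record, from the tree's torus calculus (`Torus.periodize`,
`Torus.hasSum_mFourier_scalar`, `Torus.norm_mFourierCoeff_le_of_partialDeriv_iterate`,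
`TorusPeriodizationCube`) and the directional-derivative bookkeeping `LatticePeriodic.dirIter`:

* `lift_partialDeriv_iterate` — `lift ((∂ⱼ)^m f) = (∂_{eⱼ})^m (lift f)` for smooth `f : T^d → ℂ`;
* `norm_partialDeriv_iterate_periodize_le` — `‖(∂ⱼ)^m (periodize g)‖ ≤ sup ‖D^m g‖`;
* `norm_mFourierCoeff_periodize_le` — **decay** `‖𝓕(periodize g)(k)‖ ≤ (sup ‖D^m g‖) / (2π|kⱼ|)^m`,
  and the order-zero bound `norm_mFourierCoeff_periodize_le_of_norm_le`;
* `hasSum_mFourier_periodize` / `hasSum_mFourier_of_mem_openCube` — the pointwise, absolutely convergent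
  expansion `g(y) = ∑_k 𝓕(periodize g)(k) e_k(y)` on the open cube.

HONEST LABEL: elementary Fourier bookkeeping; no crux / rung / summit statement is proved here; the
Yang–Mills mass gap is NOT proved by this file.  Cell `ym-idea-1`, width seat `ym-line-sfw-p2-w3` g37 (free hands).
-/

noncomputable section

open Set Function Filter Topology UnitAddTorus MeasureTheory
open Literature.Analysis.FunctionSpaces
open Literature.Algebra.EuclideanLattices.LatticePeriodic (dirIter dirIter_succ dirIter_eq_iteratedFDeriv
  norm_dirIter_le contDiff_dirIter)
open scoped ContDiff

namespace Summit.QuantumFields.YangMills.Theorems.AtomicSynthesisTensor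

variable {d : Type*} [Fintype d] [DecidableEq d]

/-! ## Iterated partial derivatives on the torus are iterated directional derivatives of the lift -/

/-- **`lift ((∂ⱼ)^m f) = (∂_{eⱼ})^m (lift f)`** for a smooth `f : T^d → ℂ` (`eⱼ = EuclideanSpace.single j 1`).
[folklore] -/
theorem lift_partialDeriv_iterate {f : UnitAddTorus d → ℂ} (hf : Torus.IsSmooth f) (j : d) (m : ℕ) :
    Torus.lift ((Torus.partialDeriv j)^[m] f) = dirIter (EuclideanSpace.single j (1 : ℝ)) m (Torus.lift f) := by
  induction m with
  | zero => rfl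
  | succ m ih =>
    rw [Function.iterate_succ', Function.comp_apply]
    have hsm : Torus.IsSmooth ((Torus.partialDeriv j)^[m] f) := Torus.isSmooth_partialDeriv_iterate hf j m
    rw [show Torus.partialDeriv j ((Torus.partialDeriv j)^[m] f) =
        fun x => Torus.lineDeriv ((Torus.partialDeriv j)^[m] f) x (EuclideanSpace.single j 1) from rfl,
      Torus.lift_lineDeriv (Torus.IsSmooth.isContDiff hsm (by exact_mod_cast le_top)), ih, dirIter_succ]

/-- **Uniform bound for the iterated partial derivatives of a smooth torus function** in terms of the Fréchet
derivatives of its lift: `‖(∂ⱼ)^m f (x)‖ ≤ D` whenever `‖D^m (lift f)‖ ≤ D` everywhere. [folklore] -/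
theorem norm_partialDeriv_iterate_le {f : UnitAddTorus d → ℂ} (hf : Torus.IsSmooth f) (j : d) (m : ℕ) {D : ℝ}
    (hD : ∀ y, ‖iteratedFDeriv ℝ m (Torus.lift f) y‖ ≤ D) (x : UnitAddTorus d) :
    ‖((Torus.partialDeriv j)^[m] f) x‖ ≤ D := by
  obtain ⟨y, rfl⟩ := Torus.proj_surjective x
  have h := congrFun (lift_partialDeriv_iterate hf j m) y
  rw [Torus.lift_apply] at h
  rw [h]
  refine (norm_dirIter_le hf _ m y).trans ?_
  rw [EuclideanSpace.single, PiLp.norm_single, norm_one, one_pow, mul_one]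
  exact hD y

/-! ## Cube-supported smooth functions: decay of the Fourier coefficients of the periodisation -/

/-- A function with topological support in the open unit cube has topological support in a closed ball. [folklore] -/
theorem tsupport_subset_closedBall_card {g : EuclideanSpace ℝ d → ℂ}
    (hsupp : tsupport g ⊆ {y | ∀ i, y i ∈ Ioo (0 : ℝ) 1}) :
    tsupport g ⊆ Metric.closedBall 0 (Fintype.card d) :=
  Torus.tsupport_subset_closedBall_of_openCube hsupp

/-- The periodisation of a smooth cube-supported function is smooth on the torus. [folklore] -/
theorem isSmooth_periodize_of_openCube {g : EuclideanSpace ℝ d → ℂ} (hg : ContDiff ℝ ∞ g)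
    (hsupp : tsupport g ⊆ {y | ∀ i, y i ∈ Ioo (0 : ℝ) 1}) : Torus.IsSmooth (Torus.periodize g) :=
  Torus.isSmooth_periodize hg (tsupport_subset_closedBall_card hsupp)

/-- **`‖(∂ⱼ)^m (periodize g)‖ ≤ sup ‖D^m g‖`** for smooth `g` supported in the open unit cube (the
periodisation is `g` read at the cube representative, `Torus.norm_iteratedFDeriv_perSum_le`). [folklore] -/
theorem norm_partialDeriv_iterate_periodize_le {g : EuclideanSpace ℝ d → ℂ} (hg : ContDiff ℝ ∞ g)
    (hsupp : tsupport g ⊆ {y | ∀ i, y i ∈ Ioo (0 : ℝ) 1}) (j : d) (m : ℕ) {D : ℝ}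
    (hD : ∀ y, ‖iteratedFDeriv ℝ m g y‖ ≤ D) (x : UnitAddTorus d) :
    ‖((Torus.partialDeriv j)^[m] (Torus.periodize g)) x‖ ≤ D := by
  refine norm_partialDeriv_iterate_le (isSmooth_periodize_of_openCube hg hsupp) j m (fun y => ?_) x
  rw [Torus.lift_periodize]
  exact Torus.norm_iteratedFDeriv_perSum_le (hg.of_le (by exact_mod_cast le_top)) hsupp hD y

/-- **Decay of the Fourier coefficients of a periodised cube-supported smooth function**:
`‖𝓕(periodize g)(k)‖ ≤ D / (2π|kⱼ|)^m` whenever `‖D^m g‖ ≤ D` everywhere and `kⱼ ≠ 0`.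
[folklore] -/
theorem norm_mFourierCoeff_periodize_le {g : EuclideanSpace ℝ d → ℂ} (hg : ContDiff ℝ ∞ g)
    (hsupp : tsupport g ⊆ {y | ∀ i, y i ∈ Ioo (0 : ℝ) 1}) (j : d) (m : ℕ) {k : d → ℤ} (hk : k j ≠ 0)
    {D : ℝ} (hD : ∀ y, ‖iteratedFDeriv ℝ m g y‖ ≤ D) :
    ‖mFourierCoeff (Torus.periodize g) k‖ ≤ D / (2 * Real.pi * |(k j : ℝ)|) ^ m :=
  Torus.norm_mFourierCoeff_le_of_partialDeriv_iterate (isSmooth_periodize_of_openCube hg hsupp) j m hk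
    (norm_partialDeriv_iterate_periodize_le hg hsupp j m hD)

/-- Order-zero bound: `‖𝓕(periodize g)(k)‖ ≤ sup ‖g‖` for `g` supported in the open unit cube. [folklore] -/
theorem norm_mFourierCoeff_periodize_le_of_norm_le {g : EuclideanSpace ℝ d → ℂ}
    (hsupp : tsupport g ⊆ {y | ∀ i, y i ∈ Ioo (0 : ℝ) 1}) (k : d → ℤ) {D : ℝ} (hD : ∀ y, ‖g y‖ ≤ D) :
    ‖mFourierCoeff (Torus.periodize g) k‖ ≤ D := by
  refine Torus.norm_mFourierCoeff_le_of_forall_norm_le (fun x => ?_) k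
  rw [Torus.periodize_eq_apply_repr (Torus.eq_zero_of_tsupport_subset_openCube hsupp)]
  exact hD _

/-! ## The expansion -/

/-- **Fourier expansion of the periodisation**: for smooth `g` supported in the open unit cube and every
`y ∈ ℝ^d`, `∑_k 𝓕(periodize g)(k) e_k(proj y) = perSum g y`, absolutely convergent. [folklore] -/
theorem hasSum_mFourier_periodize {g : EuclideanSpace ℝ d → ℂ} (hg : ContDiff ℝ ∞ g)
    (hsupp : tsupport g ⊆ {y | ∀ i, y i ∈ Ioo (0 : ℝ) 1}) (y : EuclideanSpace ℝ d) :
    HasSum (fun k : d → ℤ => mFourierCoeff (Torus.periodize g) k * mFourier k (Torus.proj y))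
      (Torus.perSum g y) := by
  have h := Torus.hasSum_mFourier_scalar (isSmooth_periodize_of_openCube hg hsupp) (Torus.proj y)
  rwa [Torus.periodize_proj] at h

/-- **Fourier expansion on the open cube**: for smooth `g` supported in the open unit cube and `y` in the
half-open unit cube, `g(y) = ∑_k 𝓕(periodize g)(k) e_k(proj y)`. [folklore] -/
theorem hasSum_mFourier_of_mem_unitCube {g : EuclideanSpace ℝ d → ℂ} (hg : ContDiff ℝ ∞ g)
    (hsupp : tsupport g ⊆ {y | ∀ i, y i ∈ Ioo (0 : ℝ) 1}) {y : EuclideanSpace ℝ d} (hy : y ∈ Torus.unitCube d) :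
    HasSum (fun k : d → ℤ => mFourierCoeff (Torus.periodize g) k * mFourier k (Torus.proj y)) (g y) := by
  have h := hasSum_mFourier_periodize hg hsupp y
  rwa [Torus.perSum_eq_self_of_mem_unitCube (Torus.eq_zero_of_tsupport_subset_openCube hsupp) hy] at h

/-- The coefficients of the expansion are absolutely summable. [folklore] -/
theorem summable_norm_mFourierCoeff_periodize {g : EuclideanSpace ℝ d → ℂ} (hg : ContDiff ℝ ∞ g)
    (hsupp : tsupport g ⊆ {y | ∀ i, y i ∈ Ioo (0 : ℝ) 1}) :
    Summable fun k : d → ℤ => ‖mFourierCoeff (Torus.periodize g) k‖ :=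
  Torus.summable_norm_mFourierCoeff_scalar (isSmooth_periodize_of_openCube hg hsupp)

end Summit.QuantumFields.YangMills.Theorems.AtomicSynthesisTensor

end
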